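import Summits.QuantumFields.BalabanUV.Beta.FP.TorusCompositeObjectsG

/-!
# `BalabanUV.Beta.FP.TorusCompositeCompanionSumG` — road «FP», ROUTE T (the nested tower): **THE STOREY-INDEXED COMPANION SUM**
# over an abstract one-step row family `Q : StepRows d Lc`, beside `TorusCompositeObjectsG.compRowsG` (OWNER W-FP-33-3: a reviewed `def` in
# leaf-06's shape; consumer = leaf-05's generic closing of the tower's `a1`, R-FP-74 (b); typing fact = leaf-06 g37 W-2)

WHAT ([our object — bookkeeping] + [folklore] unfoldings; nothing of Bałaban's):
* §1 `onTower Lc M n` — the IDENTITY between the two `rfl`-equal spellings `towerTorus Lc (fine Lc M) n` ∕ `towerTorus Lc M (n+1)` of the finest torus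
  of an `(n+1)`-storey tower over `M` (`TorusCompositeObjects.towerTorus_succ` is `rfl`), typed as a reducible abbreviation so that `+` ∕ `*` find their
  instances (type-class resolution does not unfold the structural recursion `towerTorus`); `onTower_apply : onTower Lc M n S a b = S a b := rfl`.
* §1 **`compSumG Lc Q G M lev rs n`** — for companions INDEXED BY THE TORUS THEY LIVE ON, `G : ∀ T, Matrix (↥(pbox T) × Fin (d+1)) (↥(pbox T) × Fin (d+1)) ℝ`
  (storey `k` of the tower over `M` reads `G (towerTorus Lc M k)`, the top storey `G M` literally), the sum over the top `n` storeys of each companion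
  pulled back to the finest torus `towerTorus Lc M n` along the composite rows `compRowsG Lc Q` below it — by PUSH-INSIDE recursion on `(M, n)` with the
  level ∕ root families indexed from the top exactly as in `compRowsG`:
  `compSumG … M lev rs 0 = 0`, `compSumG … M lev rs (n+1) = onTower Lc M n (compSumG … (fine Lc M) (lev ∘ succ) (rs ∘ succ) n) + (compRowsG Lc Q M lev rs (n+1))ᵀ * G M * compRowsG Lc Q M lev rs (n+1)`
  (both `rfl`); `compSumG_one`, `compSumG_two` (fully unfolded small depths); linearity in the companion family `compSumG_add ∕ compSumG_smul ∕ compSumG_zero_family`.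
* §2 the (0.4)-symmetrised spelling **`compSumSym Lc G M lev rs n := compSumG Lc (QSym Lc) G M lev rs n`** — REDUCIBLE, like `compRowsSym`, so every §1 lemma
  serves it by `exact`; `compSumSym_zero ∕ _succ` (`rfl`, with `compRowsSym` appearing by `rfl`), `compSumSym_one`.

WHAT THIS IS NOT: no row of any door, no hypothesis of R-FP-74's closing, no companion named (the storeys' Λ-sector companions and their rows are the ROW's
∕ the OWNER's — Q-FP-33-1); a finite sum of conjugated matrices and its unfoldings, nothing else. 0 estimates; 0∕4 row-D1 binders (hW, hR, D1Tel, D1Rep);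
NOT (C1), NOT (L2′), NOT (T-ID)∕(T-β) complete, NOT SDF, NOT D1, NOT BetaPertH, NOT continuum, NOT Clay.

HONEST DEPENDENCY (page 1, mandatory): continuum YM on T⁴ ⇐ BetaPertH ∧ nine spine estimates (0/9 proved); BetaPertH ⇐ (D1) ∧ (D4) ∧ CAP+tail;
G-an2-4 gates asym, D1 and NE2/3/4.  D1 formalisation swarm LEAF PROVER 06 (b2b-balaban-beta-d1-formalise-leaf-06 gen 37), 2026-08-24.  No existing file touched.
-/

noncomputable section

namespace Summit.QuantumFields.BalabanUV.Beta.FP.TorusCompositeCompanionSumG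

open Matrix
open Literature.MathematicalPhysics.QuantumFieldTheory.Balaban1983to89
open Literature.MathematicalPhysics.QuantumFieldTheory.Balaban1983to89.Beta
open B5Prop11Plancherel (fine)
open B6Lemma24Torus (pbox)
open Summit.QuantumFields.BalabanUV.Beta.FP.TorusCompositeObjects (towerTorus)
open Summit.QuantumFields.BalabanUV.Beta.FP.TorusCompositeObjectsG (StepRows compRowsG compRowsG_one QSym compRowsSym)

variable {d : ℕ}

/-! ## §1 The generic companion sum over an abstract one-step row family -/

section Generic

variable (Lc : ℕ)

/-- [our object — bookkeeping] **THE TOWER-TORUS TRANSPORT**: the identity map between matrices on the finest torus of an `(n+1)`-storey tower over `M`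
in its two `rfl`-equal spellings, `towerTorus Lc (fine Lc M) n` (push-inside) and `towerTorus Lc M (n+1)` (declared) — `towerTorus_succ` is `rfl`, so the
body is `S` itself; a REDUCIBLE abbreviation, present only so that `HAdd ∕ HMul` instances are found on syntactically equal index types. -/
abbrev onTower (M : Fin (d + 1) → ℕ) (n : ℕ)
    (S : Matrix (↥(pbox (towerTorus Lc (fine Lc M) n)) × Fin (d + 1)) (↥(pbox (towerTorus Lc (fine Lc M) n)) × Fin (d + 1)) ℝ) :
    Matrix (↥(pbox (towerTorus Lc M (n + 1))) × Fin (d + 1)) (↥(pbox (towerTorus Lc M (n + 1))) × Fin (d + 1)) ℝ := S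

/-- the transport is the identity on entries (both index types are the same type by `rfl`). -/
@[simp] theorem onTower_apply (M : Fin (d + 1) → ℕ) (n : ℕ)
    (S : Matrix (↥(pbox (towerTorus Lc (fine Lc M) n)) × Fin (d + 1)) (↥(pbox (towerTorus Lc (fine Lc M) n)) × Fin (d + 1)) ℝ)
    (a b : ↥(pbox (towerTorus Lc M (n + 1))) × Fin (d + 1)) : onTower Lc M n S a b = S a b := rfl

/-- the transport is additive (`rfl`). -/
theorem onTower_add (M : Fin (d + 1) → ℕ) (n : ℕ)
    (S S' : Matrix (↥(pbox (towerTorus Lc (fine Lc M) n)) × Fin (d + 1)) (↥(pbox (towerTorus Lc (fine Lc M) n)) × Fin (d + 1)) ℝ) :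
    onTower Lc M n (S + S') = onTower Lc M n S + onTower Lc M n S' := rfl

/-- the transport commutes with scalars (`rfl`). -/
theorem onTower_smul (M : Fin (d + 1) → ℕ) (n : ℕ) (c : ℝ)
    (S : Matrix (↥(pbox (towerTorus Lc (fine Lc M) n)) × Fin (d + 1)) (↥(pbox (towerTorus Lc (fine Lc M) n)) × Fin (d + 1)) ℝ) :
    onTower Lc M n (c • S) = c • onTower Lc M n S := rfl

/-- the transport of `0` is `0` (`rfl`). -/
@[simp] theorem onTower_zero (M : Fin (d + 1) → ℕ) (n : ℕ) :
    onTower Lc M n (0 : Matrix (↥(pbox (towerTorus Lc (fine Lc M) n)) × Fin (d + 1)) (↥(pbox (towerTorus Lc (fine Lc M) n)) × Fin (d + 1)) ℝ) = 0 :=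
  rfl

variable [NeZero Lc] (Q : StepRows d Lc)

/-- [our object — bookkeeping] **THE COMPANION SUM OVER `Q`**: companions `G T` on every torus `T`; for the `n`-storey tower over `M` (storeys
`M, fine Lc M, …`, finest torus `towerTorus Lc M n`) the sum of the storeys' companions, each pulled back to the finest torus along the composite rows
`compRowsG Lc Q` beneath it — PUSH-INSIDE recursion on `(M, n)`, level ∕ root families indexed FROM THE TOP as in `compRowsG`. -/
def compSumG (G : (T : Fin (d + 1) → ℕ) → Matrix (↥(pbox T) × Fin (d + 1)) (↥(pbox T) × Fin (d + 1)) ℝ) :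
    (M : Fin (d + 1) → ℕ) → [∀ μ, NeZero (M μ)] → (lev : ℕ → ℕ) → (rs : ℕ → (Fin (d + 1) → ℕ)) → (n : ℕ) →
    Matrix (↥(pbox (towerTorus Lc M n)) × Fin (d + 1)) (↥(pbox (towerTorus Lc M n)) × Fin (d + 1)) ℝ
  | _, _, _, _, 0 => 0
  | M, _, lev, rs, n + 1 =>
      onTower Lc M n (compSumG G (fine Lc M) (fun k => lev (k + 1)) (fun k => rs (k + 1)) n)
        + (compRowsG Lc Q M lev rs (n + 1))ᵀ * G M * compRowsG Lc Q M lev rs (n + 1)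

variable (G G' : (T : Fin (d + 1) → ℕ) → Matrix (↥(pbox T) × Fin (d + 1)) (↥(pbox T) × Fin (d + 1)) ℝ)
  (M : Fin (d + 1) → ℕ) [∀ μ, NeZero (M μ)] (lev : ℕ → ℕ) (rs : ℕ → (Fin (d + 1) → ℕ))

/-- unfolding, depth `0`: no storey, no companion. -/
@[simp] theorem compSumG_zero : compSumG Lc Q G M lev rs 0 = 0 := rfl

/-- unfolding, depth `n+1` — PUSH-INSIDE BY `rfl`: the lower storeys' sum over `fine Lc M` (families shifted by one), transported, plus the top
companion `G M` pulled back along the full composite `compRowsG Lc Q M lev rs (n+1)`. -/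
theorem compSumG_succ (n : ℕ) :
    compSumG Lc Q G M lev rs (n + 1)
      = onTower Lc M n (compSumG Lc Q G (fine Lc M) (fun k => lev (k + 1)) (fun k => rs (k + 1)) n)
          + (compRowsG Lc Q M lev rs (n + 1))ᵀ * G M * compRowsG Lc Q M lev rs (n + 1) := rfl

/-- [folklore] one storey: the single companion `G M` pulled back along the one-step rows `Q M (lev 1) (rs 1)`. -/
theorem compSumG_one : compSumG Lc Q G M lev rs 1 = (Q M (lev 1) (rs 1))ᵀ * G M * Q M (lev 1) (rs 1) := by
  rw [compSumG_succ, compRowsG_one]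
  exact zero_add _

/-- [folklore] two storeys, fully unfolded: the storey-1 companion `G (fine Lc M)` along the finer one-step rows, read on `towerTorus Lc M 1 = fine Lc M`
through the transport, plus the top companion along the two-fold composite. -/
theorem compSumG_two :
    compSumG Lc Q G M lev rs 2
      = onTower Lc M 1 ((Q (fine Lc M) (lev 2) (rs 2))ᵀ * G (fine Lc M) * Q (fine Lc M) (lev 2) (rs 2))
          + (compRowsG Lc Q M lev rs 2)ᵀ * G M * compRowsG Lc Q M lev rs 2 := by
  rw [compSumG_succ, compSumG_one]

/-- [folklore] the companion sum of the ZERO family vanishes at every depth. -/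
theorem compSumG_zero_family : ∀ (M : Fin (d + 1) → ℕ) [∀ μ, NeZero (M μ)] (lev : ℕ → ℕ) (rs : ℕ → (Fin (d + 1) → ℕ)) (n : ℕ),
    compSumG Lc Q (fun _ => 0) M lev rs n = 0
  | _, _, _, _, 0 => rfl
  | M, _, lev, rs, n + 1 => by
      rw [compSumG_succ, compSumG_zero_family (fine Lc M) _ _ n, Matrix.mul_zero, Matrix.zero_mul, add_zero]
      rfl

/-- [folklore] the companion sum is ADDITIVE in the companion family (storey by storey: `Matrix.mul_add ∕ add_mul`). -/
theorem compSumG_add : ∀ (M : Fin (d + 1) → ℕ) [∀ μ, NeZero (M μ)] (lev : ℕ → ℕ) (rs : ℕ → (Fin (d + 1) → ℕ)) (n : ℕ),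
    compSumG Lc Q (G + G') M lev rs n = compSumG Lc Q G M lev rs n + compSumG Lc Q G' M lev rs n
  | _, _, _, _, 0 => (add_zero _).symm
  | M, _, lev, rs, n + 1 => by
      rw [compSumG_succ, compSumG_succ, compSumG_succ, compSumG_add (fine Lc M) _ _ n, onTower_add, Pi.add_apply, Matrix.mul_add,
        Matrix.add_mul]
      abel

/-- [folklore] the companion sum is HOMOGENEOUS in the companion family (`Matrix.mul_smul ∕ smul_mul`). -/
theorem compSumG_smul (c : ℝ) : ∀ (M : Fin (d + 1) → ℕ) [∀ μ, NeZero (M μ)] (lev : ℕ → ℕ) (rs : ℕ → (Fin (d + 1) → ℕ)) (n : ℕ),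
    compSumG Lc Q (c • G) M lev rs n = c • compSumG Lc Q G M lev rs n
  | _, _, _, _, 0 => (smul_zero _).symm
  | M, _, lev, rs, n + 1 => by
      rw [compSumG_succ, compSumG_succ, compSumG_smul c (fine Lc M) _ _ n, onTower_smul, Pi.smul_apply, Matrix.mul_smul, Matrix.smul_mul,
        smul_add]

end Generic

/-! ## §2 The (0.4)-symmetrised spelling -/

section Sym

variable (Lc : ℕ) [NeZero Lc] (G : (T : Fin (d + 1) → ℕ) → Matrix (↥(pbox T) × Fin (d + 1)) (↥(pbox T) × Fin (d + 1)) ℝ)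

/-- [our object — bookkeeping] **THE (0.4)-SYMMETRISED COMPANION SUM** = the generic one at the root-free family `QSym Lc` (REDUCIBLE abbreviation, like
`compRowsSym`: every §1 lemma applies by `exact` ∕ token substitution `Q ↦ QSym Lc`). -/
abbrev compSumSym (M : Fin (d + 1) → ℕ) [∀ μ, NeZero (M μ)] (lev : ℕ → ℕ) (rs : ℕ → (Fin (d + 1) → ℕ)) (n : ℕ) :
    Matrix (↥(pbox (towerTorus Lc M n)) × Fin (d + 1)) (↥(pbox (towerTorus Lc M n)) × Fin (d + 1)) ℝ :=
  compSumG Lc (QSym Lc) G M lev rs n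

variable (M : Fin (d + 1) → ℕ) [∀ μ, NeZero (M μ)] (lev : ℕ → ℕ) (rs : ℕ → (Fin (d + 1) → ℕ))

/-- unfolding, depth `0`. -/
theorem compSumSym_zero : compSumSym Lc G M lev rs 0 = 0 := rfl

/-- unfolding, depth `n+1` — push-inside by `rfl`, with the sym composite `compRowsSym` appearing by `rfl`. -/
theorem compSumSym_succ (n : ℕ) :
    compSumSym Lc G M lev rs (n + 1)
      = onTower Lc M n (compSumSym Lc G (fine Lc M) (fun k => lev (k + 1)) (fun k => rs (k + 1)) n)
          + (compRowsSym Lc M lev rs (n + 1))ᵀ * G M * compRowsSym Lc M lev rs (n + 1) := rfl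

/-- one storey, sym spelling — the generic lemma by `exact`. -/
theorem compSumSym_one : compSumSym Lc G M lev rs 1 = (QSym Lc M (lev 1) (rs 1))ᵀ * G M * QSym Lc M (lev 1) (rs 1) :=
  compSumG_one Lc (QSym Lc) G M lev rs

end Sym

end Summit.QuantumFields.BalabanUV.Beta.FP.TorusCompositeCompanionSumG

end
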